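import Summits.Ventures.Crystal3D.StickySpheres.EightCensusCover
import Summits.Ventures.Crystal3D.StickySpheres.ContactEight
import Mathlib.Data.List.GetD
import HarnessLib

/-!
# The eight-ball census: block sorting and slot bookkeeping (shared finite checks)

Venture `Crystal3D` (cell `pub-crystal3d`, seat p2). ENUM-A of `ineq/FORMAL-C9.md`, preliminaries shared by the census theorems
`EightCensusMinFour` (all degrees `≥ 4`) and `EightCensusMinThree` (a vertex of degree `3`): the block permutations of `Fin 8`
given as image lists (`tau`), the sorting lemmas `sort3` / `sort4` for the blocks `{0,1,2}` / `{3,4,5,6}` and the resulting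
`exists_blockSort`, and the bookkeeping of the pair slots `pidx` (injectivity, the mask `ALL28`, relabelled edge lists, the
target-map lengths of the pattern table `cpatList`). All statements are finite checks (`decide`) or short bookkeeping.

HONEST FRAMING: finite combinatorics only; nothing about crystallization.
-/

noncomputable section

open Finset

namespace Summit.Ventures.Crystal3D

namespace EightCensus

open EightSearch SimpleGraph

/-! ### Block sorting (finite checks) -/

/-- The six permutations of `Fin 8` permuting `{0,1,2}` and fixing the rest (as image lists). [folklore] -/
def T3L : List (List (Fin 8)) := [[0, 1, 2, 3, 4, 5, 6, 7], [0, 2, 1, 3, 4, 5, 6, 7], [1, 0, 2, 3, 4, 5, 6, 7], [1, 2, 0, 3, 4, 5, 6, 7], [2, 0, 1, 3, 4, 5, 6, 7], [2, 1, 0, 3, 4, 5, 6, 7]]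

/-- The twenty-four permutations of `Fin 8` permuting `{3,4,5,6}` and fixing the rest (as image lists). [folklore] -/
def T4L : List (List (Fin 8)) :=
  [[0, 1, 2, 3, 4, 5, 6, 7], [0, 1, 2, 3, 4, 6, 5, 7], [0, 1, 2, 3, 5, 4, 6, 7], [0, 1, 2, 3, 5, 6, 4, 7], [0, 1, 2, 3, 6, 4, 5, 7], [0, 1, 2, 3, 6, 5, 4, 7], [0, 1, 2, 4, 3, 5, 6, 7], [0, 1, 2, 4, 3, 6, 5, 7],
   [0, 1, 2, 4, 5, 3, 6, 7], [0, 1, 2, 4, 5, 6, 3, 7], [0, 1, 2, 4, 6, 3, 5, 7], [0, 1, 2, 4, 6, 5, 3, 7], [0, 1, 2, 5, 3, 4, 6, 7], [0, 1, 2, 5, 3, 6, 4, 7], [0, 1, 2, 5, 4, 3, 6, 7], [0, 1, 2, 5, 4, 6, 3, 7],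
   [0, 1, 2, 5, 6, 3, 4, 7], [0, 1, 2, 5, 6, 4, 3, 7], [0, 1, 2, 6, 3, 4, 5, 7], [0, 1, 2, 6, 3, 5, 4, 7], [0, 1, 2, 6, 4, 3, 5, 7], [0, 1, 2, 6, 4, 5, 3, 7], [0, 1, 2, 6, 5, 3, 4, 7], [0, 1, 2, 6, 5, 4, 3, 7]]

/-- The map `j ↦ t[j]` of an image list. [folklore] -/
def tau (t : List (Fin 8)) (j : Fin 8) : Fin 8 := t.getD j.val 0

/-- Block structure of the `T3L` maps: injective, fix `3,…,7`, map `{0,1,2}` into itself. [folklore] -/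
theorem T3L_block : ∀ t ∈ T3L, Function.Injective (tau t) ∧ (∀ j : Fin 8, 3 ≤ j.val → tau t j = j) ∧
    (∀ j : Fin 8, j.val < 3 → (tau t j).val < 3) := by
  decide +kernel

/-- Block structure of the `T4L` maps: injective, fix `0,1,2,7`, map `{3,…,6}` into itself. [folklore] -/
theorem T4L_block : ∀ t ∈ T4L, Function.Injective (tau t) ∧ (∀ j : Fin 8, j.val < 3 → tau t j = j) ∧ tau t 7 = 7 ∧
    (∀ j : Fin 8, 3 ≤ j.val → j.val < 7 → 3 ≤ (tau t j).val ∧ (tau t j).val < 7) := by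
  decide +kernel

/-- Every triple is sorted by one of the `T3L` maps. [folklore] -/
theorem sort3 : ∀ a b c : Fin 8, ∃ t ∈ T3L,
    (![a, b, c, 0, 0, 0, 0, 0] : Fin 8 → Fin 8) (tau t 0) ≤ ![a, b, c, 0, 0, 0, 0, 0] (tau t 1) ∧
    (![a, b, c, 0, 0, 0, 0, 0] : Fin 8 → Fin 8) (tau t 1) ≤ ![a, b, c, 0, 0, 0, 0, 0] (tau t 2) := by
  decide +kernel

/-- Every quadruple is sorted by one of the `T4L` maps. [folklore] -/
theorem sort4 : ∀ a b c d : Fin 8, ∃ t ∈ T4L,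
    (![0, 0, 0, a, b, c, d, 0] : Fin 8 → Fin 8) (tau t 3) ≤ ![0, 0, 0, a, b, c, d, 0] (tau t 4) ∧
    (![0, 0, 0, a, b, c, d, 0] : Fin 8 → Fin 8) (tau t 4) ≤ ![0, 0, 0, a, b, c, d, 0] (tau t 5) ∧
    (![0, 0, 0, a, b, c, d, 0] : Fin 8 → Fin 8) (tau t 5) ≤ ![0, 0, 0, a, b, c, d, 0] (tau t 6) := by
  decide +kernel

/-- Reading `![D 0, D 1, D 2, 0, …]` at an index `< 3`. [folklore] -/
theorem vec3_apply (D : Fin 8 → Fin 8) :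
    ∀ j : Fin 8, j.val < 3 → (![D 0, D 1, D 2, 0, 0, 0, 0, 0] : Fin 8 → Fin 8) j = D j := by
  intro j hj
  fin_cases j <;> simp_all

/-- Reading `![0, 0, 0, D 3, D 4, D 5, D 6, 0]` at an index in `[3,7)`. [folklore] -/
theorem vec4_apply (D : Fin 8 → Fin 8) :
    ∀ j : Fin 8, 3 ≤ j.val → j.val < 7 → (![0, 0, 0, D 3, D 4, D 5, D 6, 0] : Fin 8 → Fin 8) j = D j := by
  intro j hj hj'
  fin_cases j <;> simp_all

/-- **Sorted normal form.** For any `D : Fin 8 → Fin 8` (the degrees) there is an injective relabelling fixing `7` and the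
block `{3,…,6}` setwise along which `D` is non-decreasing inside `{0,1,2}` and inside `{3,…,6}`. [folklore] -/
theorem exists_blockSort (D : Fin 8 → Fin 8) : ∃ σ : Fin 8 → Fin 8, Function.Injective σ ∧ σ 7 = 7 ∧
    (∀ j : Fin 8, j.val < 7 → (3 ≤ (σ j).val ↔ 3 ≤ j.val)) ∧
    D (σ 0) ≤ D (σ 1) ∧ D (σ 1) ≤ D (σ 2) ∧ D (σ 3) ≤ D (σ 4) ∧ D (σ 4) ≤ D (σ 5) ∧ D (σ 5) ≤ D (σ 6) := by
  obtain ⟨p, hp, h01, h12⟩ := sort3 (D 0) (D 1) (D 2)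
  obtain ⟨q, hq, h34, h45, h56⟩ := sort4 (D 3) (D 4) (D 5) (D 6)
  obtain ⟨hαi, hαfix, hαlt⟩ := T3L_block p hp
  obtain ⟨hβi, hβfix, hβ7, hβin⟩ := T4L_block q hq
  have b0 : tau q 0 = 0 := hβfix 0 (by decide)
  have b1 : tau q 1 = 1 := hβfix 1 (by decide)
  have b2 : tau q 2 = 2 := hβfix 2 (by decide)
  have i3 := hβin 3 (by decide) (by decide)
  have i4 := hβin 4 (by decide) (by decide)
  have i5 := hβin 5 (by decide) (by decide)
  have i6 := hβin 6 (by decide) (by decide)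
  refine ⟨fun j => tau p (tau q j), hαi.comp hβi, ?_, ?_, ?_, ?_, ?_, ?_, ?_⟩
  · show tau p (tau q 7) = 7
    rw [hβ7, hαfix 7 (by decide)]
  · intro j hj7
    show 3 ≤ (tau p (tau q j)).val ↔ 3 ≤ j.val
    by_cases hj : j.val < 3
    · rw [hβfix j hj]
      have := hαlt j hj
      constructor <;> intro h <;> omega
    · have hin := hβin j (by omega) hj7
      rw [hαfix (tau q j) hin.1]
      constructor <;> intro _ <;> omega
  · show D (tau p (tau q 0)) ≤ D (tau p (tau q 1))
    rw [b0, b1]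
    rwa [vec3_apply D (tau p 0) (hαlt 0 (by decide)), vec3_apply D (tau p 1) (hαlt 1 (by decide))] at h01
  · show D (tau p (tau q 1)) ≤ D (tau p (tau q 2))
    rw [b1, b2]
    rwa [vec3_apply D (tau p 1) (hαlt 1 (by decide)), vec3_apply D (tau p 2) (hαlt 2 (by decide))] at h12
  · show D (tau p (tau q 3)) ≤ D (tau p (tau q 4))
    rw [hαfix (tau q 3) i3.1, hαfix (tau q 4) i4.1]
    rwa [vec4_apply D (tau q 3) i3.1 i3.2, vec4_apply D (tau q 4) i4.1 i4.2] at h34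
  · show D (tau p (tau q 4)) ≤ D (tau p (tau q 5))
    rw [hαfix (tau q 4) i4.1, hαfix (tau q 5) i5.1]
    rwa [vec4_apply D (tau q 4) i4.1 i4.2, vec4_apply D (tau q 5) i5.1 i5.2] at h45
  · show D (tau p (tau q 5)) ≤ D (tau p (tau q 6))
    rw [hαfix (tau q 5) i5.1, hαfix (tau q 6) i6.1]
    rwa [vec4_apply D (tau q 5) i5.1 i5.2, vec4_apply D (tau q 6) i6.1 i6.2] at h56

/-! ### Slot bookkeeping -/

/-- `pidx · v` is injective away from `v`. [folklore] -/
theorem pidx_left_inj : ∀ v u u' : V, u ≠ v → u' ≠ v → pidx u v = pidx u' v → u = u' := by decide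

/-- Which unordered pair a slot is. [folklore] -/
theorem pidx_eq_cases : ∀ a b u v : V, a < b → u ≠ v → pidx a b = pidx u v → (u = a ∧ v = b) ∨ (u = b ∧ v = a) := by
  decide

/-- Slots are `< 28`, and `ALL28` has exactly the bits `< 28`. [folklore] -/
theorem testBit_ALL28 : ∀ a b : V, a ≠ b → ALL28.testBit (pidx a b) = true := by decide

/-- Relabelling lists: `app t` is injective on `Fin k` when `t` has no duplicates and length `≥ k`. [folklore] -/
theorem app_injective {k : ℕ} {t : List V} (hnd : t.Nodup) (hlen : k ≤ t.length) : Function.Injective (app (k := k) t) := by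
  intro i j hij
  simp only [app] at hij
  rw [List.getD_eq_getElem (l := t) (d := 0) (by omega), List.getD_eq_getElem (l := t) (d := 0) (by omega)] at hij
  exact Fin.ext ((hnd.getElem_inj_iff).1 hij)

/-- Membership in a relabelled edge list. [folklore] -/
theorem mem_relabel {k : ℕ} (t : List V) {l : List (Fin k × Fin k)} {e : Fin k × Fin k} (he : e ∈ l) :
    (app t e.1, app t e.2) ∈ relabel t l := List.mem_map.2 ⟨e, he, rfl⟩

/-- Expected length of the relabelling list of a pattern (`0` for the tuple kinds). [folklore] -/
def CPat.tlen : CPat → ℕ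
  | .bipyr _ => 6
  | .open8 _ _ => 8
  | .snub _ => 8
  | _ => 0

/-- Lengths and distinctness of the relabelling lists (kernel decision). [folklore] -/
theorem cpatList_tmap : ∀ p ∈ cpatList, p.tmap.Nodup ∧ p.tmap.length = p.tlen := by
  decide +kernel

end EightCensus

end Summit.Ventures.Crystal3D

end
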